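/-
Copyright (c) 2026 the pub-hodgecm-mathlib formalisation cell (harness21).  Prover seat hodgecm-mathlib-K2Liu-p05 (g8), Track B «K2-LIT»,
#184♮ = hLiu418 = `stmt-HodgeConjecture-24832`; #42F′ FACE-G organ F4 (G-gen), B3-b letter (D-let) = THE TWO DERIVATIVE LETTERS (DX⁺)(DX⁻) OF ★ B3-b FILE 2c
`K2LiuArchSWDataInductionOfRecord.good_tupleVec` AT THE MODEL (F4 lead K2Liu-p27 (g2) RE-DEAL 2026-09-05T00:05:53Z; design K2Liu-p23 (g2) `CENSUS-Dlet-…` 8a23d4a2868a0b63;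
consumer LH7-p07 (g2) `K2LiuArchSWDataInductionFinal`).  THEOREMS ONLY (no `def`, no `instance`, no notation, no local instance, no named-fact hypothesis, no `sorry`);
lane `--supports stmt-HodgeConjecture-24832 --as helper`.
-/
import Summits.HodgeConjecture.HodgeConjecture.Theorems.K2LiuArchSWPlaceTransportGenFamily   -- ★ FILE 3∕3 (this seat): `hasArchDeriv_genFamily_fock_of_weakDeriv`
import Summits.HodgeConjecture.HodgeConjecture.Theorems.K2LiuArchSWPlaceTransport            -- ★ FILE 1∕2 (this seat): the (T2) letters + `exists_fock_hypOpGenC ∕ _rotBoostGen`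
import Summits.HodgeConjecture.HodgeConjecture.Theorems.K2LiuArchSWDataTuplesDefs             -- ★ B3-b FILE 1 (LH7-p07): `tupleVec`, `frame_tupleVec_eq_tensorPi`, `tupleRest_update`
import HarnessLib

/-!
# Crux `HLiu418`, FACE-G organ F4 (G-gen), B3-b letter (D-let): the derivative letters `hDXp ∕ hDXm` of ★ `K2LiuArchSWDataInductionOfRecord.good_tupleVec`
# AT THE MODEL, from ONE per-place letter — the one-place homomorphism `ψ_σ` with its (J2⊗-arch) identity and its curve ∕ character data

Cell `hodgecm-mathlib`, crux item hLiu418 = `stmt-HodgeConjecture-24832`; squad K2 ∕ K2Liu; prover K2Liu-p05 (g8); F4 lead K2Liu-p27 (g2), consumer LH7-p07 (g2)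
(`K2LiuArchSWDataInductionFinal`), box K2Liu-audit1 ∕ K2E5-r02.

THE SOCKET.  ★ FILE 2c `good_tupleVec` (LH7-p07, p863464) carries, per real place `σ`, frozen tuple `rest`, root `i : Fin 2 × Fin 2`, slot polynomial `F` and finite
datum `f`, the two `Good`-free derivative letters (DX⁺) `hDXp` ∕ (DX⁻) `hDXm`: «`∃ X ∈ 𝔲` (arch skew), `c : ℂ`, `G` with `B⁻¹G = hypOpGen_{i}(B⁻¹F)` (resp. its
`μ₀(D_{π∕2})`-conjugate) and `HasArchDeriv hX (genFamily (E(tupleVec (update rest σ F) ⊗ f)) s₀) (genFamily (E(tupleVec (update rest σ (c • F + G)) ⊗ f)) s₀)`».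
THIS FILE pays both, at the generic place frames `(R σ, S σ, eP σ, eQ σ)` of ★ FILE 1, from ONE per-place letter BY VALUE, **`hψ`**: at every real `σ` a one-place
homomorphism `ψ_σ : U(2,2) →* H(L⁺ ⊗ ℝ)` with (a) the (J2⊗-arch) identity `tensorEmb (archEmb (ψ_σ h)) = archEmb (placeSecJ_𝕎 σ (eP σ) (eQ σ) (toBig (h,1), 1))` (★ (r-b)'s
`hsec`; at the junction-frame data of ★ `K2LiuArchJunctionFrameData.exists_junctionFrameData` it is ★ `hsec_placeSec_relabel`) and (b) for every `Y ∈ 𝔲(2,2)` a letter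
`X ∈ archSkew` with the curve identity `archExp hX s = archEmb (ψ_σ (exp sY))` and a derivative `c_X` of the `detChar α` character leg (★
`K2LiuArchPlaceSecExp.exists_archSkew_archExp_eq_placeSecJ_expMem` + ★ F2 `K2LiuSwSectionTensorArchOrbitDeriv.hasDerivAt_coe_detChar_archExp` at `ψ_σ := placeSecJ_𝔻 σ (·, 1)`).
The frames are kept GENERIC exactly as in ★ FILE 2c and in the pivot of record ★ p863344 (whose right-leg identity `hkk` is the partner of `hψ`'s (a)); the
composition of record discharges `hψ` at its frames.
PROOF per `(σ, rest, i, F, f)`: `X hX c_X` from `hψ σ` at `Y := Y_{i}` (resp. `Ad((κ k_P(π∕2)).1) Y_{i}`), `G` from ★ `exists_fock_hypOpGenC` (resp. `_rotBoostGen`),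
witness `c := c_X + η′_Y`, and ★ FILE 3∕3 `hasArchDeriv_genFamily_fock_of_weakDeriv` fed with ★ (T2) `hasDerivAt_weilRepPair_expMem_boost` (resp. `_conj_boost`) and the
σ-slot readings **`frame_tupleVec_update`** (§1: ★ FILE 1 `frame_tupleVec_eq_tensorPi` + `Function.update_self` + `tupleRest_update` — the slot `F` and the slot
`c • F + G` have the SAME rest factor).
* §1 `frame_tupleVec_update` — `𝒥_σ (tupleVec (update rest σ P)) = (e_* B⁻¹P) ⊠ B⁻¹(tupleRest σ rest)`;
* §2 **`hDXp_of_onePlaceLetter`**, **`hDXm_of_onePlaceLetter`** — (DX⁺), (DX⁻) in ★ FILE 2c's binder BYTES, from `hψ`.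
References: [KudlaRallis1994, §1]; [Folland1989, §1.7 (1.81), §4.2 Prop. (4.39)]; [Howe1989, §3]; [KonnoKonno2007, §3.3, Lemma 5.2]; [BorelJacquet1979, §4.1].
HONEST LABEL.  Count-neutral helper: `HC_CM` is proved only modulo the 7 printed citations (2 remaining named inputs: hLiu418 = `stmt-HodgeConjecture-24832`,
h413 = `stmt-HodgeConjecture-24833`) until rung 0 closes; this file closes no socket.
-/

set_option autoImplicit false
set_option linter.dupNamespace false -- the mandated namespace repeats `HodgeConjecture.HodgeConjecture`

noncomputable section
open scoped Classical Matrix TensorProduct Kronecker SchwartzMap MatrixGroups Real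
open NumberField NumberField.InfinitePlace NumberField.mixedEmbedding IsDedekindDomain MvPolynomial
open Literature.Analysis.SegalBargmann Literature.Analysis.Distribution Literature.RepresentationTheory.HeisenbergGroup
open Literature.NumberTheory.Automorphic Literature.NumberTheory.Automorphic.UnitaryGroup Literature.NumberTheory.GaloisRepresentations
open Literature.NumberTheory.Weil1964 Literature.NumberTheory.Weil1964.MpS Literature.NumberTheory.Weil1964.UnitaryWeil
open Literature.RepresentationTheory.HarrisKudlaSweet1996
open Literature.RepresentationTheory.KonnoKonno2007 hiding LetterKind letterOf letterGen letterOf_boost letterOf_torus letterOf_torus_eq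
  letterGen_boost letterGen_torus letterGen_mem_lie exp_smul_letterGen
open Literature.RepresentationTheory.KonnoKonno2007.RealDualPair Literature.NumberTheory.K2Lit.SiegelDoubled
open Literature.NumberTheory.GelbartRogawski1991 Literature.NumberTheory.GelbartRogawski1991.GRConstruction Literature.NumberTheory.GelbartRogawski1991.UnitaryDualPair
open Literature.NumberTheory.GelbartRogawski1991.UnitaryDualPair.LocalSplitting
open Literature.NumberTheory.Automorphic.Liu2021 Literature.NumberTheory.Automorphic.Liu2021.Def411WeilCarriers Literature.NumberTheory.Automorphic.Liu2021.Def411WeilCarriersDoubling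
open Summit.HodgeConjecture.HodgeConjecture.Cruxes.HLiu418.K2LiuArchSectionPlaceBlock
open Summit.HodgeConjecture.HodgeConjecture.Cruxes.HLiu418 (K2LiuArchOneParameterOrbitDefs.archEmb K2LiuArchOneParameterOrbitDefs.archExp)
open Summit.HodgeConjecture.HodgeConjecture.Cruxes.HLiu418.K2LiuSwSectionArchOrbit Summit.HodgeConjecture.HodgeConjecture.Cruxes.HLiu418.K2LiuArchWeilJunctionTransport
open Summit.HodgeConjecture.HodgeConjecture.Cruxes.HLiu418.K2LiuFaceGLetterDefs (genFamily HasArchDeriv)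
open Summit.HodgeConjecture.HodgeConjecture.Cruxes.HLiu418.K2LiuU22AdaptedBasis (boostGen boostGen_mem_lie)
open Summit.HodgeConjecture.HodgeConjecture.Cruxes.HLiu418.K2LiuArchSWPlaceTransport
open Summit.HodgeConjecture.HodgeConjecture.Cruxes.HLiu418.K2LiuArchSWPlaceTransportGenFamily (hasArchDeriv_genFamily_fock_of_weakDeriv)
open Summit.HodgeConjecture.HodgeConjecture.Cruxes.HLiu418.K2LiuArchSWDataTuplesDefs

namespace Summit.HodgeConjecture.HodgeConjecture.Cruxes.HLiu418.K2LiuArchSWDataDerivLetters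

variable (L : Type) [Field L] [NumberField L] [IsCMField L] {n : ℕ} (e : Fin 2 × Fin 1 ≃ Fin n)
  (dV : Fin 2 → L) (hdV : ∀ i, IsCMField.complexConj L (dV i) = dV i) (hdV0 : ∀ i, dV i ≠ 0)
  (dW : Fin 1 → L) (hdW : ∀ i, IsCMField.complexConj L (dW i) = dW i) (hdW0 : ∀ i, dW i ≠ 0)
  {M' n' : ℕ} (eW : Fin 1 × Fin 3 ≃ Fin M') (e' : Fin 2 × Fin M' ≃ Fin n')
  (dV' : Fin 3 → L) (hdV' : ∀ k, IsCMField.complexConj L (dV' k) = dV' k) (hdV'0 : ∀ k, dV' k ≠ 0)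
  (χb : HeckeCharacter L) (hχbu : χb.IsUnitary) (hχbs : IsSplittingChar L 1 χb)
  (α : UnitaryGroup.adelicOne (Fp L) L (IsCMField.complexConj L) →* ℂˣ) (𝒦 : IwasawaDatum L e dV hdV dW hdW)
  (R S : {v : InfinitePlace (Fp L) // v.IsReal} → Type) [∀ σ, Fintype (R σ)] [∀ σ, DecidableEq (R σ)] [∀ σ, Fintype (S σ)] [∀ σ, DecidableEq (S σ)]
  (eP : ∀ σ : {v : InfinitePlace (Fp L) // v.IsReal}, PosIdx (signVec (cmPlaceOver L) (fun k => Sum.elim (cmGramEntry L e' dV hdV (tensorFrame L dW eW dV') (tensorFrame_real L dW hdW eW dV' hdV')) (-cmGramEntry L e' dV hdV (tensorFrame L dW eW dV') (tensorFrame_real L dW hdW eW dV' hdV')) ((LocalSplitting.e₂ n').symm k)) (imagUnit L) σ) ≃ (Fin 2 × R σ) ⊕ (Fin 2 × S σ))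
  (eQ : ∀ σ : {v : InfinitePlace (Fp L) // v.IsReal}, NegIdx (signVec (cmPlaceOver L) (fun k => Sum.elim (cmGramEntry L e' dV hdV (tensorFrame L dW eW dV') (tensorFrame_real L dW hdW eW dV' hdV')) (-cmGramEntry L e' dV hdV (tensorFrame L dW eW dV') (tensorFrame_real L dW hdW eW dV' hdV')) ((LocalSplitting.e₂ n').symm k)) (imagUnit L) σ) ≃ (Fin 2 × S σ) ⊕ (Fin 2 × R σ))

-- the CM sign frame and the three relabellings elaborate slowly (as ★ FILE 1 ∕ ★ FILE 2c: 4 000 000 heartbeats on the statements)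
set_option maxHeartbeats 4000000

/-! ## §1 The σ-slot reading of an updated tuple -/

/-- **THE σ-SLOT READING OF AN UPDATED TUPLE**: `𝒥_σ (tupleVec (update rest σ P)) = (e_* B⁻¹P) ⊠ B⁻¹(tupleRest σ rest)` — ★ FILE 1 `frame_tupleVec_eq_tensorPi` with
`(update rest σ P) σ = P` and `tupleRest σ (update rest σ P) = tupleRest σ rest` (★ `tupleRest_update`): the rest factor does not see the σ-slot.
[cite: Folland1989, §1.7 (1.81)] [cite: Weil1964, Chap. I n° 12 p. 160] -/
theorem frame_tupleVec_update (σ : {v : InfinitePlace (Fp L) // v.IsReal})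
    (rest : ((τ : {v : InfinitePlace (Fp L) // v.IsReal}) → MvPolynomial (DPIdx (Fin 2) (Fin 2) (R τ) (S τ)) ℂ)) (P : MvPolynomial (DPIdx (Fin 2) (Fin 2) (R σ) (S σ)) ℂ) :
    ((((schwartzTransport (scaledFrame (Fp L) (Fin (n' + n')) (placeScale (n' + n') fun v => sqrtAbs (signVec (cmPlaceOver L) (fun k => Sum.elim (cmGramEntry L e' dV hdV (tensorFrame L dW eW dV') (tensorFrame_real L dW hdW eW dV' hdV')) (-cmGramEntry L e' dV hdV (tensorFrame L dW eW dV') (tensorFrame_real L dW hdW eW dV'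
          hdV')) ((LocalSplitting.e₂ n').symm k)) (imagUnit L) v)) (placeScale_ne_zero (n' + n') (sqrtAbs_signVec_ne_zero (IsCMField.complexConj_ne_one L) (cmPlaceOver_smul L) (complexConj_imagUnit L) (imagUnit_ne_zero L) (gramD_gram_realDiagonal_entry_ne_zero L e' dV hdV (tensorFrame L dW eW dV') (tensorFrame_real L dW hdW eW
          dV' hdV') hdV0 (tensorFrame_ne_zero L dW eW dV' hdW0 hdV'0)))))).trans (schwartzTransport (reindexCLE (placeSplitEquiv (signSplit (signVec (cmPlaceOver L) (fun k => Sum.elim (cmGramEntry L e' dV hdV (tensorFrame L dW eW dV') (tensorFrame_real L dW hdW eW dV' hdV')) (-cmGramEntry L e' dV hdV (tensorFrame L dW eW dV')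
          (tensorFrame_real L dW hdW eW dV' hdV')) ((LocalSplitting.e₂ n').symm k)) (imagUnit L) σ)) σ)))).trans (schwartzTransport (reindexCLE (Equiv.sumCongr (unitJunctionIdx (PosIdx (signVec (cmPlaceOver L) (fun k => Sum.elim (cmGramEntry L e' dV hdV (tensorFrame L dW eW dV') (tensorFrame_real L dW hdW eW dV' hdV'))
          (-cmGramEntry L e' dV hdV (tensorFrame L dW eW dV') (tensorFrame_real L dW hdW eW dV' hdV')) ((LocalSplitting.e₂ n').symm k)) (imagUnit L) σ)) (NegIdx (signVec (cmPlaceOver L) (fun k => Sum.elim (cmGramEntry L e' dV hdV (tensorFrame L dW eW dV') (tensorFrame_real L dW hdW eW dV' hdV')) (-cmGramEntry L e' dV hdV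
          (tensorFrame L dW eW dV') (tensorFrame_real L dW hdW eW dV' hdV')) ((LocalSplitting.e₂ n').symm k)) (imagUnit L) σ))).symm (Equiv.refl (Fin (n' + n') × {v : {v : InfinitePlace (Fp L) // v.IsReal} // v ≠ σ})))))).trans (schwartzTransport (reindexCLE (Equiv.sumCongr (dpIdxCongr (PosIdx (signVec (cmPlaceOver L) (fun k
          => Sum.elim (cmGramEntry L e' dV hdV (tensorFrame L dW eW dV') (tensorFrame_real L dW hdW eW dV' hdV')) (-cmGramEntry L e' dV hdV (tensorFrame L dW eW dV') (tensorFrame_real L dW hdW eW dV' hdV')) ((LocalSplitting.e₂ n').symm k)) (imagUnit L) σ)) (NegIdx (signVec (cmPlaceOver L) (fun k => Sum.elim (cmGramEntry L e'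
          dV hdV (tensorFrame L dW eW dV') (tensorFrame_real L dW hdW eW dV' hdV')) (-cmGramEntry L e' dV hdV (tensorFrame L dW eW dV') (tensorFrame_real L dW hdW eW dV' hdV')) ((LocalSplitting.e₂ n').symm k)) (imagUnit L) σ)) Unit Empty ((Fin 2 × R σ) ⊕ (Fin 2 × S σ)) ((Fin 2 × S σ) ⊕ (Fin 2 × R σ)) Unit Empty (eP σ) (eQ σ) (Equiv.refl Unit)
          (Equiv.refl Empty)).symm (Equiv.refl (Fin (n' + n') × {v : {v : InfinitePlace (Fp L) // v.IsReal} // v ≠ σ})))))) (tupleVec L dV hdV hdV0 dW hdW hdW0 eW e' dV' hdV' hdV'0 R S eP eQ (Function.update rest σ P)) =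
      tensorPi ((schwartzTransport (reindexCLE (unitJunctionIdx ((Fin 2 × R σ) ⊕ (Fin 2 × S σ)) ((Fin 2 × S σ) ⊕ (Fin 2 × R σ))).symm)) (binvPi P)) (binvPi (tupleRest (fun τ => unitJunctionIdx ((Fin 2 × R τ) ⊕ (Fin 2 × S τ)) ((Fin 2 × S τ) ⊕ (Fin 2 × R τ))) (frameSlotEquiv L dV hdV dW hdW eW e' dV' hdV' R S eP eQ) σ rest)) := by
  rw [frame_tupleVec_eq_tensorPi, Function.update_self, tupleRest_update]

/-! ## §2 The two derivative letters from the one-place letter `hψ` -/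

include hdW0 hdV'0 in
/-- **(DX⁺) AT THE MODEL — ★ FILE 2c `good_tupleVec`'s binder `hDXp` BYTES, from the one-place letter `hψ`.**  See the module docstring.
[cite: KudlaRallis1994, §1] [cite: Folland1989, §4.2 Prop. (4.39)] [cite: Howe1989, §3] [cite: KonnoKonno2007, §3.3, Lemma 5.2] -/
theorem hDXp_of_onePlaceLetter {t : InfinitePlace L → ℤ} (ht : χb.HasUnitaryArchType t 0) (hodd : ∀ w, Odd (t w))
    (hψ : letI : LieRing (Matrix (Fin 2 ⊕ Fin 2) (Fin 2 ⊕ Fin 2) ℂ) := LieRing.ofAssociativeRing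
      ∀ σ : {v : InfinitePlace (Fp L) // v.IsReal}, ∃ ψ : UForm (Fin 2) (Fin 2) →* UnitaryGroup.arch (Fp L) L (IsCMField.complexConj L) (n + n) (hermD L e dV hdV dW hdW),
      (∀ h : UForm (Fin 2) (Fin 2),
        tensorEmb L e dV hdV dW hdW eW e' dV' hdV' (K2LiuArchOneParameterOrbitDefs.archEmb (Fp L) L (IsCMField.complexConj L) (n + n) (hermD L e dV hdV dW hdW) (ψ h)) =
          K2LiuArchOneParameterOrbitDefs.archEmb (Fp L) L (IsCMField.complexConj L) (n' + n') (hermD L e' dV hdV (tensorFrame L dW eW dV') (tensorFrame_real L dW hdW eW dV' hdV'))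
            (placeSecJ L (IsCMField.complexConj L) (n' + n') (IsCMField.complexConj_ne_one L) (cmPlaceOver L) (cmPlaceOver_smul L) _ (gramD_gram_realDiagonal_entry_ne_zero L e' dV hdV (tensorFrame L dW eW dV') (tensorFrame_real L dW hdW eW dV' hdV') hdV0 (tensorFrame_ne_zero L dW eW dV' hdW0 hdV'0)) (complexConj_imagUnit L)
            (imagUnit_ne_zero L) σ (cmPlaceOver_comap L) (gramD_eq_diagonal_cm L e' dV hdV (tensorFrame L dW eW dV') (tensorFrame_real L dW hdW eW dV' hdV')) (J := hermD L e' dV hdV (tensorFrame L dW eW dV') (tensorFrame_real L dW hdW eW dV' hdV')) rfl (complexConj_smul_infinitePlace L) (eP σ) (eQ σ) ((toBig (Fin 2) (Fin 2) (R σ) (S σ) (h, 1), (1 : UForm Unit Empty)) : Ginf ((Fin 2 × R σ) ⊕ (Fin 2 × S σ)) ((Fin 2 × S σ) ⊕ (Fin 2 × R σ)) Unit Empty))) ∧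
      ∀ Y : ↥(uFormGroup (Fin 2) (Fin 2)).lie.toSubmodule, ∃ (X : Matrix (Fin (n + n)) (Fin (n + n)) (mixedSpace L)) (hX : X ∈ archSkew (Fp L) L (IsCMField.complexConj L) (n + n) (hermD L e dV hdV dW hdW)) (c : ℂ),
        (∀ s : ℝ, K2LiuArchOneParameterOrbitDefs.archExp (Fp L) L (IsCMField.complexConj L) (n + n) (hermD L e dV hdV dW hdW) hX s = K2LiuArchOneParameterOrbitDefs.archEmb (Fp L) L (IsCMField.complexConj L) (n + n) (hermD L e dV hdV dW hdW) (ψ ((uFormGroup (Fin 2) (Fin 2)).expMem ⟨((s • Y : ↥(uFormGroup (Fin 2) (Fin 2)).lie.toSubmodule) : Matrix (Fin 2 ⊕ Fin 2) (Fin 2 ⊕ Fin 2) ℂ), (s • Y).2⟩ : UForm (Fin 2) (Fin 2)))) ∧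
        HasDerivAt (fun t' : ℝ => ((((DoubledWeilDetTwist.detChar L e dV hdV hdV0 dW hdW hdW0 α) (K2LiuArchOneParameterOrbitDefs.archExp (Fp L) L (IsCMField.complexConj L) (n + n) (hermD L e dV hdV dW hdW) hX t')) : ℂˣ) : ℂ)) c 0) :
    ∀ (σ : {v : InfinitePlace (Fp L) // v.IsReal}) (rest : ((τ : {v : InfinitePlace (Fp L) // v.IsReal}) → MvPolynomial (DPIdx (Fin 2) (Fin 2) (R τ) (S τ)) ℂ)) (i : Fin 2 × Fin 2) (F : MvPolynomial (DPIdx (Fin 2) (Fin 2) (R σ) (S σ)) ℂ) (f : FinSB (Fp L) (Fin (n' + n'))),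
      ∃ (X : Matrix (Fin (n + n)) (Fin (n + n)) (mixedSpace L)) (hX : X ∈ archSkew (Fp L) L (IsCMField.complexConj L) (n + n) (hermD L e dV hdV dW hdW))
        (c : ℂ) (G : MvPolynomial (DPIdx (Fin 2) (Fin 2) (R σ) (S σ)) ℂ), binvPi G = hypOpGenC (R σ) (S σ) i.1 i.2 (binvPi F) ∧
        HasArchDeriv L e dV hdV dW hdW hX (fun h => genFamily L e dV hdV hdV0 dW hdW hdW0 eW e' dV' hdV' hdV'0 χb hχbu hχbs α 𝒦 (piSchwartzBruhatEquiv (Fp L) (Fin (n' + n')) (tupleVec L dV hdV hdV0 dW hdW hdW0 eW e' dV' hdV' hdV'0 R S eP eQ (Function.update rest σ F) ⊗ₜ[ℂ] f)) ((((3 : ℕ) : ℂ) - (n : ℂ)) / 2) h)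
          (fun h => genFamily L e dV hdV hdV0 dW hdW hdW0 eW e' dV' hdV' hdV'0 χb hχbu hχbs α 𝒦 (piSchwartzBruhatEquiv (Fp L) (Fin (n' + n')) (tupleVec L dV hdV hdV0 dW hdW hdW0 eW e' dV' hdV' hdV'0 R S eP eQ (Function.update rest σ (c • F + G)) ⊗ₜ[ℂ] f)) ((((3 : ℕ) : ℂ) - (n : ℂ)) / 2) h) := by
  letI : LieRing (Matrix (Fin 2 ⊕ Fin 2) (Fin 2 ⊕ Fin 2) ℂ) := LieRing.ofAssociativeRing
  intro σ rest i F f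
  obtain ⟨ψ, hsec, hY⟩ := hψ σ
  obtain ⟨X, hX, c, hcurve, hθ⟩ := hY (⟨boostGen i.1 i.2, boostGen_mem_lie i.1 i.2⟩ : ↥(uFormGroup (Fin 2) (Fin 2)).lie.toSubmodule)
  obtain ⟨G, hG⟩ := exists_fock_hypOpGenC (R σ) (S σ) i.1 i.2 F
  have key := hasArchDeriv_genFamily_fock_of_weakDeriv L e dV hdV hdV0 dW hdW hdW0 eW e' dV' hdV' hdV'0 σ (eP σ) (eQ σ) hX χb hχbu hχbs ht hodd α 𝒦 f ψ hsec
    (⟨boostGen i.1 i.2, boostGen_mem_lie i.1 i.2⟩ : ↥(uFormGroup (Fin 2) (Fin 2)).lie.toSubmodule) hcurve hθ F G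
    (fun T => by rw [hG]; exact hasDerivAt_weilRepPair_expMem_boost i.1 i.2 (binvPi F) T)
    (binvPi (tupleRest (fun τ => unitJunctionIdx ((Fin 2 × R τ) ⊕ (Fin 2 × S τ)) ((Fin 2 × S τ) ⊕ (Fin 2 × R τ))) (frameSlotEquiv L dV hdV dW hdW eW e' dV' hdV' R S eP eQ) σ rest)) (frame_tupleVec_update L dV hdV hdV0 dW hdW hdW0 eW e' dV' hdV' hdV'0 R S eP eQ σ rest F)
  exact ⟨X, hX, _, G, hG, key _ (frame_tupleVec_update L dV hdV hdV0 dW hdW hdW0 eW e' dV' hdV' hdV'0 R S eP eQ σ rest _)⟩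

include hdW0 hdV'0 in
/-- **(DX⁻) AT THE MODEL — ★ FILE 2c `good_tupleVec`'s binder `hDXm` BYTES, from the one-place letter `hψ`.**  See the module docstring.
[cite: KudlaRallis1994, §1] [cite: Folland1989, §4.2 Prop. (4.39)] [cite: Howe1989, §3] [cite: KonnoKonno2007, §3.3, Lemma 5.2] -/
theorem hDXm_of_onePlaceLetter {t : InfinitePlace L → ℤ} (ht : χb.HasUnitaryArchType t 0) (hodd : ∀ w, Odd (t w))
    (hψ : letI : LieRing (Matrix (Fin 2 ⊕ Fin 2) (Fin 2 ⊕ Fin 2) ℂ) := LieRing.ofAssociativeRing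
      ∀ σ : {v : InfinitePlace (Fp L) // v.IsReal}, ∃ ψ : UForm (Fin 2) (Fin 2) →* UnitaryGroup.arch (Fp L) L (IsCMField.complexConj L) (n + n) (hermD L e dV hdV dW hdW),
      (∀ h : UForm (Fin 2) (Fin 2),
        tensorEmb L e dV hdV dW hdW eW e' dV' hdV' (K2LiuArchOneParameterOrbitDefs.archEmb (Fp L) L (IsCMField.complexConj L) (n + n) (hermD L e dV hdV dW hdW) (ψ h)) =
          K2LiuArchOneParameterOrbitDefs.archEmb (Fp L) L (IsCMField.complexConj L) (n' + n') (hermD L e' dV hdV (tensorFrame L dW eW dV') (tensorFrame_real L dW hdW eW dV' hdV'))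
            (placeSecJ L (IsCMField.complexConj L) (n' + n') (IsCMField.complexConj_ne_one L) (cmPlaceOver L) (cmPlaceOver_smul L) _ (gramD_gram_realDiagonal_entry_ne_zero L e' dV hdV (tensorFrame L dW eW dV') (tensorFrame_real L dW hdW eW dV' hdV') hdV0 (tensorFrame_ne_zero L dW eW dV' hdW0 hdV'0)) (complexConj_imagUnit L)
            (imagUnit_ne_zero L) σ (cmPlaceOver_comap L) (gramD_eq_diagonal_cm L e' dV hdV (tensorFrame L dW eW dV') (tensorFrame_real L dW hdW eW dV' hdV')) (J := hermD L e' dV hdV (tensorFrame L dW eW dV') (tensorFrame_real L dW hdW eW dV' hdV')) rfl (complexConj_smul_infinitePlace L) (eP σ) (eQ σ) ((toBig (Fin 2) (Fin 2) (R σ) (S σ) (h, 1), (1 : UForm Unit Empty)) : Ginf ((Fin 2 × R σ) ⊕ (Fin 2 × S σ)) ((Fin 2 × S σ) ⊕ (Fin 2 × R σ)) Unit Empty))) ∧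
      ∀ Y : ↥(uFormGroup (Fin 2) (Fin 2)).lie.toSubmodule, ∃ (X : Matrix (Fin (n + n)) (Fin (n + n)) (mixedSpace L)) (hX : X ∈ archSkew (Fp L) L (IsCMField.complexConj L) (n + n) (hermD L e dV hdV dW hdW)) (c : ℂ),
        (∀ s : ℝ, K2LiuArchOneParameterOrbitDefs.archExp (Fp L) L (IsCMField.complexConj L) (n + n) (hermD L e dV hdV dW hdW) hX s = K2LiuArchOneParameterOrbitDefs.archEmb (Fp L) L (IsCMField.complexConj L) (n + n) (hermD L e dV hdV dW hdW) (ψ ((uFormGroup (Fin 2) (Fin 2)).expMem ⟨((s • Y : ↥(uFormGroup (Fin 2) (Fin 2)).lie.toSubmodule) : Matrix (Fin 2 ⊕ Fin 2) (Fin 2 ⊕ Fin 2) ℂ), (s • Y).2⟩ : UForm (Fin 2) (Fin 2)))) ∧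
        HasDerivAt (fun t' : ℝ => ((((DoubledWeilDetTwist.detChar L e dV hdV hdV0 dW hdW hdW0 α) (K2LiuArchOneParameterOrbitDefs.archExp (Fp L) L (IsCMField.complexConj L) (n + n) (hermD L e dV hdV dW hdW) hX t')) : ℂˣ) : ℂ)) c 0) :
    ∀ (σ : {v : InfinitePlace (Fp L) // v.IsReal}) (rest : ((τ : {v : InfinitePlace (Fp L) // v.IsReal}) → MvPolynomial (DPIdx (Fin 2) (Fin 2) (R τ) (S τ)) ℂ)) (i : Fin 2 × Fin 2) (F : MvPolynomial (DPIdx (Fin 2) (Fin 2) (R σ) (S σ)) ℂ) (f : FinSB (Fp L) (Fin (n' + n'))),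
      ∃ (X : Matrix (Fin (n + n)) (Fin (n + n)) (mixedSpace L)) (hX : X ∈ archSkew (Fp L) L (IsCMField.complexConj L) (n + n) (hermD L e dV hdV dW hdW))
        (c : ℂ) (G : MvPolynomial (DPIdx (Fin 2) (Fin 2) (R σ) (S σ)) ℂ), binvPi G = unitaryOpPi (phaseU (R σ) (S σ) i.1 (π / 2)) (hypOpGenC (R σ) (S σ) i.1 i.2 (unitaryOpPi (phaseU (R σ) (S σ) i.1 (π / 2))⁻¹ (binvPi F))) ∧
        HasArchDeriv L e dV hdV dW hdW hX (fun h => genFamily L e dV hdV hdV0 dW hdW hdW0 eW e' dV' hdV' hdV'0 χb hχbu hχbs α 𝒦 (piSchwartzBruhatEquiv (Fp L) (Fin (n' + n')) (tupleVec L dV hdV hdV0 dW hdW hdW0 eW e' dV' hdV' hdV'0 R S eP eQ (Function.update rest σ F) ⊗ₜ[ℂ] f)) ((((3 : ℕ) : ℂ) - (n : ℂ)) / 2) h)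
          (fun h => genFamily L e dV hdV hdV0 dW hdW hdW0 eW e' dV' hdV' hdV'0 χb hχbu hχbs α 𝒦 (piSchwartzBruhatEquiv (Fp L) (Fin (n' + n')) (tupleVec L dV hdV hdV0 dW hdW hdW0 eW e' dV' hdV' hdV'0 R S eP eQ (Function.update rest σ (c • F + G)) ⊗ₜ[ℂ] f)) ((((3 : ℕ) : ℂ) - (n : ℂ)) / 2) h) := by
  letI : LieRing (Matrix (Fin 2 ⊕ Fin 2) (Fin 2 ⊕ Fin 2) ℂ) := LieRing.ofAssociativeRing
  intro σ rest i F f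
  obtain ⟨ψ, hsec, hY⟩ := hψ σ
  obtain ⟨X, hX, c, hcurve, hθ⟩ := hY (⟨((UForm.kV (Fin 2) (Fin 2) (phaseP (R σ) (S σ) i.1 (π / 2)).1 : GL (Fin 2 ⊕ Fin 2) ℂ) : Matrix (Fin 2 ⊕ Fin 2) (Fin 2 ⊕ Fin 2) ℂ) * boostGen i.1 i.2 * (((UForm.kV (Fin 2) (Fin 2) (phaseP (R σ) (S σ) i.1 (π / 2)).1 : GL (Fin 2 ⊕ Fin 2) ℂ)⁻¹ : GL (Fin 2 ⊕ Fin 2) ℂ) : Matrix (Fin 2 ⊕ Fin 2) (Fin 2 ⊕ Fin 2) ℂ), (uFormGroup (Fin 2) (Fin 2)).conj_mem_lie _ (UForm.kV (Fin 2) (Fin 2) (phaseP (R σ) (S σ) i.1 (π / 2)).1).2 _ (boostGen_mem_lie i.1 i.2)⟩ : ↥(uFormGroup (Fin 2) (Fin 2)).lie.toSubmodule)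
  obtain ⟨G, hG⟩ := exists_fock_rotBoostGen (R σ) (S σ) i.1 i.2 (π / 2) F
  have key := hasArchDeriv_genFamily_fock_of_weakDeriv L e dV hdV hdV0 dW hdW hdW0 eW e' dV' hdV' hdV'0 σ (eP σ) (eQ σ) hX χb hχbu hχbs ht hodd α 𝒦 f ψ hsec
    (⟨((UForm.kV (Fin 2) (Fin 2) (phaseP (R σ) (S σ) i.1 (π / 2)).1 : GL (Fin 2 ⊕ Fin 2) ℂ) : Matrix (Fin 2 ⊕ Fin 2) (Fin 2 ⊕ Fin 2) ℂ) * boostGen i.1 i.2 * (((UForm.kV (Fin 2) (Fin 2) (phaseP (R σ) (S σ) i.1 (π / 2)).1 : GL (Fin 2 ⊕ Fin 2) ℂ)⁻¹ : GL (Fin 2 ⊕ Fin 2) ℂ) : Matrix (Fin 2 ⊕ Fin 2) (Fin 2 ⊕ Fin 2) ℂ), (uFormGroup (Fin 2) (Fin 2)).conj_mem_lie _ (UForm.kV (Fin 2) (Fin 2) (phaseP (R σ) (S σ) i.1 (π / 2)).1).2 _ (boostGen_mem_lie i.1 i.2)⟩ : ↥(uFormGroup (Fin 2) (Fin 2)).lie.toSubmodule)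 hcurve hθ F G
    (fun T => by rw [hG]; exact hasDerivAt_weilRepPair_expMem_conj_boost i.1 i.2 (π / 2) (binvPi F) T)
    (binvPi (tupleRest (fun τ => unitJunctionIdx ((Fin 2 × R τ) ⊕ (Fin 2 × S τ)) ((Fin 2 × S τ) ⊕ (Fin 2 × R τ))) (frameSlotEquiv L dV hdV dW hdW eW e' dV' hdV' R S eP eQ) σ rest)) (frame_tupleVec_update L dV hdV hdV0 dW hdW hdW0 eW e' dV' hdV' hdV'0 R S eP eQ σ rest F)
  exact ⟨X, hX, _, G, hG, key _ (frame_tupleVec_update L dV hdV hdV0 dW hdW hdW0 eW e' dV' hdV' hdV'0 R S eP eQ σ rest _)⟩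

end Summit.HodgeConjecture.HodgeConjecture.Cruxes.HLiu418.K2LiuArchSWDataDerivLetters

end
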